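import Summits.CriticalPhenomena.PercolationContinuityZ3.Theorems.PercNearOneGluingNoHeavyLowerTailSuperTerminalQuarticHubEvents
import Literature.Probability.Percolation.ProdBernoulliRusso
import HarnessLib

/-!
# Four-terminal hub graphs: the single-hub probabilities in closed form (THEOREM H4, part 3b)

Support file for crux `stmt-CriticalPhenomena-4575` (`NoHeavyLowerTail`), seat `prim-facecert` gen 21 (`--supports stmt-CriticalPhenomena-4575`);
memo `run/shared/lean/prim/prim-l12/prim-facecert/FINDING-gen21-V4-HUB-GRAPHS.md` §1.  No sorries, standard axioms.

For a hub `h` of a four-terminal hub graph (terminals `c u a b` pairwise distinct; star pairs `s(c,h), s(u,h), s(a,h), s(b,h)` with weights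
`r, su, sa, sb`) the probabilities of the hub parts of the separation events of `…SuperTerminalQuarticHubEvents` are polynomials in the four
weights.  `real_hubEvent` is the sixteen-atom formula (`RussoPath.prodBernoulli_real_eq_sum_powerset` on the four star pairs); the eight
closed forms used by THEOREM H4 follow (`x̄ = 1 − x`; `n = s̄ūs̄ās̄b + r̄(su s̄a s̄b + s̄u sa s̄b + s̄u s̄a sb)`, `p = r̄ su sa s̄b`, `d = r s̄u s̄a sb`,
`e = r s̄b(su s̄a + s̄u sa)`, `sac = r su sa s̄b`, `γ = r̄ + r s̄ūs̄ās̄b`, `mB = s̄b + r̄ s̄ūs̄ā sb`):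
`P(hSep{c}) = γ`, `P(hSep{b}) = mB`, `P(hSep{c} ∩ hSep{b}) = n + p`, `P(hSep{u,a}) = n + p + d`, `P(hSep{u} ∩ hSep{a}) = n + d`,
`P(hSep{c} ∩ hSep{u} ∩ hSep{a}) = n`, `P(hSep{b} ∩ ¬(u ∧ a open)) = n + e`, `P(u, a open, b closed) = p + sac`.  [this work]
-/

namespace Summit.CriticalPhenomena.PercolationContinuityZ3.Theorems.SuperTerminalQuarticHubProb

open MeasureTheory Set
open Literature.Probability.Percolation Literature.Probability.LatticeModels
open Summit.CriticalPhenomena.PercolationContinuityZ3.Theorems.ThreePointHubEvents (determinedBy_of_iff)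
open Summit.CriticalPhenomena.PercolationContinuityZ3.Theorems.SuperTerminalQuarticHubEvents
open scoped Classical

variable {V : Type*}

/-- Distinct terminals give distinct star pairs. [this work] -/
theorem spair_ne {x y h : V} (hxy : x ≠ y) : s(x, h) ≠ s(y, h) := by
  intro e
  rcases Sym2.eq_iff.1 e with ⟨e1, -⟩ | ⟨e1, e2⟩
  · exact hxy e1
  · exact hxy (e1.trans e2)

/-- **Sixteen-atom formula** for the probability of an event depending only on the four star pairs of a hub `h`
(terminals pairwise distinct): the sum over the `2⁴` open/closed patterns of the indicator times the pattern weight. [this work] -/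
theorem real_hubEvent (w : Sym2 V → unitInterval) {c u a b h : V} (hcu : c ≠ u) (hca : c ≠ a) (hcb : c ≠ b) (hua : u ≠ a) (hub : u ≠ b) (hab : a ≠ b) {A : Set (BondConfig V)} (P4 : Prop → Prop → Prop → Prop → Prop)
    (hA : ∀ ω : BondConfig V, ω ∈ A ↔ P4 (s(c, h) ∈ ω) (s(u, h) ∈ ω) (s(a, h) ∈ ω) (s(b, h) ∈ ω)) :
    (prodBernoulli w).real A =
      (if P4 True True True True then (w s(c, h) : ℝ) * (w s(u, h) : ℝ) * (w s(a, h) : ℝ) * (w s(b, h) : ℝ) else 0) +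
      (if P4 True True True False then (w s(c, h) : ℝ) * (w s(u, h) : ℝ) * (w s(a, h) : ℝ) * (1 - (w s(b, h) : ℝ)) else 0) +
      (if P4 True True False True then (w s(c, h) : ℝ) * (w s(u, h) : ℝ) * (1 - (w s(a, h) : ℝ)) * (w s(b, h) : ℝ) else 0) +
      (if P4 True True False False then (w s(c, h) : ℝ) * (w s(u, h) : ℝ) * (1 - (w s(a, h) : ℝ)) * (1 - (w s(b, h) : ℝ)) else 0) +
      (if P4 True False True True then (w s(c, h) : ℝ) * (1 - (w s(u, h) : ℝ)) * (w s(a, h) : ℝ) * (w s(b, h) : ℝ) else 0) +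
      (if P4 True False True False then (w s(c, h) : ℝ) * (1 - (w s(u, h) : ℝ)) * (w s(a, h) : ℝ) * (1 - (w s(b, h) : ℝ)) else 0) +
      (if P4 True False False True then (w s(c, h) : ℝ) * (1 - (w s(u, h) : ℝ)) * (1 - (w s(a, h) : ℝ)) * (w s(b, h) : ℝ) else 0) +
      (if P4 True False False False then (w s(c, h) : ℝ) * (1 - (w s(u, h) : ℝ)) * (1 - (w s(a, h) : ℝ)) * (1 - (w s(b, h) : ℝ)) else 0) +
      (if P4 False True True True then (1 - (w s(c, h) : ℝ)) * (w s(u, h) : ℝ) * (w s(a, h) : ℝ) * (w s(b, h) : ℝ) else 0) +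
      (if P4 False True True False then (1 - (w s(c, h) : ℝ)) * (w s(u, h) : ℝ) * (w s(a, h) : ℝ) * (1 - (w s(b, h) : ℝ)) else 0) +
      (if P4 False True False True then (1 - (w s(c, h) : ℝ)) * (w s(u, h) : ℝ) * (1 - (w s(a, h) : ℝ)) * (w s(b, h) : ℝ) else 0) +
      (if P4 False True False False then (1 - (w s(c, h) : ℝ)) * (w s(u, h) : ℝ) * (1 - (w s(a, h) : ℝ)) * (1 - (w s(b, h) : ℝ)) else 0) +
      (if P4 False False True True then (1 - (w s(c, h) : ℝ)) * (1 - (w s(u, h) : ℝ)) * (w s(a, h) : ℝ) * (w s(b, h) : ℝ) else 0) +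
      (if P4 False False True False then (1 - (w s(c, h) : ℝ)) * (1 - (w s(u, h) : ℝ)) * (w s(a, h) : ℝ) * (1 - (w s(b, h) : ℝ)) else 0) +
      (if P4 False False False True then (1 - (w s(c, h) : ℝ)) * (1 - (w s(u, h) : ℝ)) * (1 - (w s(a, h) : ℝ)) * (w s(b, h) : ℝ) else 0) +
      (if P4 False False False False then (1 - (w s(c, h) : ℝ)) * (1 - (w s(u, h) : ℝ)) * (1 - (w s(a, h) : ℝ)) * (1 - (w s(b, h) : ℝ)) else 0) := by
  have ecu := spair_ne (h := h) hcu
  have eca := spair_ne (h := h) hca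
  have ecb := spair_ne (h := h) hcb
  have eua := spair_ne (h := h) hua
  have eub := spair_ne (h := h) hub
  have eab := spair_ne (h := h) hab
  set K : Finset (Sym2 V) := {s(c, h), s(u, h), s(a, h), s(b, h)} with hK
  have hdet : DeterminedBy A (↑K : Set (Sym2 V)) := by
    refine determinedBy_of_iff fun ω ω' hF => ?_
    rw [hA, hA, hF _ (by simp [hK]), hF _ (by simp [hK]), hF _ (by simp [hK]), hF _ (by simp [hK])]
  rw [RussoPath.prodBernoulli_real_eq_sum_powerset hdet w]
  have h1 : s(c, h) ∉ ({s(u, h), s(a, h), s(b, h)} : Finset (Sym2 V)) := by simp [ecu, eca, ecb]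
  have h2 : s(u, h) ∉ ({s(a, h), s(b, h)} : Finset (Sym2 V)) := by simp [eua, eub]
  have h3 : s(a, h) ∉ ({s(b, h)} : Finset (Sym2 V)) := by simp [eab]
  have hps : ({s(b, h)} : Finset (Sym2 V)).powerset = {∅, {s(b, h)}} := by
    ext t
    simp only [Finset.mem_powerset, Finset.subset_singleton_iff, Finset.mem_insert, Finset.mem_singleton]
  have hne0 : (∅ : Finset (Sym2 V)) ∉ ({{s(b, h)}} : Finset (Finset (Sym2 V))) := by simp
  rw [hK]
  simp only [Finset.sum_powerset_insert h1, Finset.sum_powerset_insert h2, Finset.sum_powerset_insert h3, hps,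
    Finset.sum_insert hne0, Finset.sum_singleton,
    Finset.prod_insert h1, Finset.prod_insert h2, Finset.prod_insert h3, Finset.prod_singleton]
  simp only [hA, Finset.coe_insert, Finset.coe_empty, Finset.coe_singleton, mem_insert_iff, mem_empty_iff_false, mem_singleton_iff,
    Finset.mem_insert, Finset.notMem_empty, Finset.mem_singleton, ecu, eca, ecb, eua, eub, eab, ecu.symm, eca.symm, ecb.symm,
    eua.symm, eub.symm, eab.symm, or_false, or_true, if_true, if_false]
  ring_nf

variable [DecidableEq V]

section memlemmas
variable {c u a b h : V} {ω : BondConfig V}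

/-- `hSep {c}` unfolded. [this work] -/
theorem mem_hSep_c (hcu : c ≠ u) (hca : c ≠ a) (hcb : c ≠ b) (hua : u ≠ a) (hub : u ≠ b) (hab : a ≠ b) :
    ω ∈ hSep {c} c u a b h ↔ ¬ (s(c, h) ∈ ω ∧ (s(u, h) ∈ ω ∨ s(a, h) ∈ ω ∨ s(b, h) ∈ ω)) := by
  simp only [hSep, mem_setOf_eq, Finset.mem_singleton, exists_eq_left, Finset.mem_sdiff, mem_terms4]
  refine not_congr (and_congr_right fun _ => ?_)
  constructor
  · rintro ⟨y, ⟨hy, hyc⟩, hyω⟩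
    rcases hy with rfl | rfl | rfl | rfl
    · exact (hyc rfl).elim
    · exact Or.inl hyω
    · exact Or.inr (Or.inl hyω)
    · exact Or.inr (Or.inr hyω)
  · rintro (h1 | h1 | h1)
    · exact ⟨u, ⟨Or.inr (Or.inl rfl), fun e => hcu e.symm⟩, h1⟩
    · exact ⟨a, ⟨Or.inr (Or.inr (Or.inl rfl)), fun e => hca e.symm⟩, h1⟩
    · exact ⟨b, ⟨Or.inr (Or.inr (Or.inr rfl)), fun e => hcb e.symm⟩, h1⟩

/-- `hSep {b}` unfolded. [this work] -/
theorem mem_hSep_b (hcu : c ≠ u) (hca : c ≠ a) (hcb : c ≠ b) (hua : u ≠ a) (hub : u ≠ b) (hab : a ≠ b) :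
    ω ∈ hSep {b} c u a b h ↔ ¬ (s(b, h) ∈ ω ∧ (s(c, h) ∈ ω ∨ s(u, h) ∈ ω ∨ s(a, h) ∈ ω)) := by
  simp only [hSep, mem_setOf_eq, Finset.mem_singleton, exists_eq_left, Finset.mem_sdiff, mem_terms4]
  refine not_congr (and_congr_right fun _ => ?_)
  constructor
  · rintro ⟨y, ⟨hy, hyb⟩, hyω⟩
    rcases hy with rfl | rfl | rfl | rfl
    · exact Or.inl hyω
    · exact Or.inr (Or.inl hyω)
    · exact Or.inr (Or.inr hyω)
    · exact (hyb rfl).elim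
  · rintro (h1 | h1 | h1)
    · exact ⟨c, ⟨Or.inl rfl, hcb⟩, h1⟩
    · exact ⟨u, ⟨Or.inr (Or.inl rfl), hub⟩, h1⟩
    · exact ⟨a, ⟨Or.inr (Or.inr (Or.inl rfl)), hab⟩, h1⟩

/-- `hSep {u}` unfolded. [this work] -/
theorem mem_hSep_u (hcu : c ≠ u) (hca : c ≠ a) (hcb : c ≠ b) (hua : u ≠ a) (hub : u ≠ b) (hab : a ≠ b) :
    ω ∈ hSep {u} c u a b h ↔ ¬ (s(u, h) ∈ ω ∧ (s(c, h) ∈ ω ∨ s(a, h) ∈ ω ∨ s(b, h) ∈ ω)) := by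
  simp only [hSep, mem_setOf_eq, Finset.mem_singleton, exists_eq_left, Finset.mem_sdiff, mem_terms4]
  refine not_congr (and_congr_right fun _ => ?_)
  constructor
  · rintro ⟨y, ⟨hy, hyu⟩, hyω⟩
    rcases hy with rfl | rfl | rfl | rfl
    · exact Or.inl hyω
    · exact (hyu rfl).elim
    · exact Or.inr (Or.inl hyω)
    · exact Or.inr (Or.inr hyω)
  · rintro (h1 | h1 | h1)
    · exact ⟨c, ⟨Or.inl rfl, hcu⟩, h1⟩
    · exact ⟨a, ⟨Or.inr (Or.inr (Or.inl rfl)), fun e => hua e.symm⟩, h1⟩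
    · exact ⟨b, ⟨Or.inr (Or.inr (Or.inr rfl)), fun e => hub e.symm⟩, h1⟩

/-- `hSep {a}` unfolded. [this work] -/
theorem mem_hSep_a (hcu : c ≠ u) (hca : c ≠ a) (hcb : c ≠ b) (hua : u ≠ a) (hub : u ≠ b) (hab : a ≠ b) :
    ω ∈ hSep {a} c u a b h ↔ ¬ (s(a, h) ∈ ω ∧ (s(c, h) ∈ ω ∨ s(u, h) ∈ ω ∨ s(b, h) ∈ ω)) := by
  simp only [hSep, mem_setOf_eq, Finset.mem_singleton, exists_eq_left, Finset.mem_sdiff, mem_terms4]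
  refine not_congr (and_congr_right fun _ => ?_)
  constructor
  · rintro ⟨y, ⟨hy, hya⟩, hyω⟩
    rcases hy with rfl | rfl | rfl | rfl
    · exact Or.inl hyω
    · exact Or.inr (Or.inl hyω)
    · exact (hya rfl).elim
    · exact Or.inr (Or.inr hyω)
  · rintro (h1 | h1 | h1)
    · exact ⟨c, ⟨Or.inl rfl, hca⟩, h1⟩
    · exact ⟨u, ⟨Or.inr (Or.inl rfl), hua⟩, h1⟩
    · exact ⟨b, ⟨Or.inr (Or.inr (Or.inr rfl)), fun e => hab e.symm⟩, h1⟩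

/-- `hSep {u, a}` unfolded. [this work] -/
theorem mem_hSep_ua (hcu : c ≠ u) (hca : c ≠ a) (hcb : c ≠ b) (hua : u ≠ a) (hub : u ≠ b) (hab : a ≠ b) :
    ω ∈ hSep {u, a} c u a b h ↔ ¬ ((s(u, h) ∈ ω ∨ s(a, h) ∈ ω) ∧ (s(c, h) ∈ ω ∨ s(b, h) ∈ ω)) := by
  simp only [hSep, mem_setOf_eq, Finset.mem_insert, Finset.mem_singleton, Finset.mem_sdiff, mem_terms4]
  refine not_congr (and_congr ?_ ?_)
  · constructor
    · rintro ⟨x, (rfl | rfl), hx⟩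
      · exact Or.inl hx
      · exact Or.inr hx
    · rintro (h1 | h1)
      · exact ⟨u, Or.inl rfl, h1⟩
      · exact ⟨a, Or.inr rfl, h1⟩
  · constructor
    · rintro ⟨y, ⟨hy, hyua⟩, hyω⟩
      rcases hy with rfl | rfl | rfl | rfl
      · exact Or.inl hyω
      · exact (hyua (Or.inl rfl)).elim
      · exact (hyua (Or.inr rfl)).elim
      · exact Or.inr hyω
    · rintro (h1 | h1)
      · exact ⟨c, ⟨Or.inl rfl, fun e => e.elim (fun e => hcu e) (fun e => hca e)⟩, h1⟩
      · exact ⟨b, ⟨Or.inr (Or.inr (Or.inr rfl)), fun e => e.elim (fun e => hub e.symm) (fun e => hab e.symm)⟩, h1⟩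

end memlemmas

section closedforms
set_option linter.unusedSimpArgs false
variable (w : Sym2 V → unitInterval) {c u a b h : V}

/-- `P(hSep{c}) = γ = r̄ + r·s̄ū·s̄ā·s̄b`. [this work] -/
theorem real_hSep_c (hcu : c ≠ u) (hca : c ≠ a) (hcb : c ≠ b) (hua : u ≠ a) (hub : u ≠ b) (hab : a ≠ b) :
    (prodBernoulli w).real (hSep {c} c u a b h) = ((1 - (w s(c, h) : ℝ)) + (w s(c, h) : ℝ) * (1 - (w s(u, h) : ℝ)) * (1 - (w s(a, h) : ℝ)) * (1 - (w s(b, h) : ℝ))) := by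
  rw [real_hubEvent w hcu hca hcb hua hub hab (fun oc ou oa ob => ¬ (oc ∧ (ou ∨ oa ∨ ob))) (fun ω => mem_hSep_c hcu hca hcb hua hub hab)]
  simp only [true_and, false_and, true_or, false_or, or_true, or_false, not_true_eq_false, not_false_eq_true, if_true, if_false]
  ring

/-- `P(hSep{b}) = mB = s̄b + r̄·s̄ū·s̄ā·sb`. [this work] -/
theorem real_hSep_b (hcu : c ≠ u) (hca : c ≠ a) (hcb : c ≠ b) (hua : u ≠ a) (hub : u ≠ b) (hab : a ≠ b) :
    (prodBernoulli w).real (hSep {b} c u a b h) = ((1 - (w s(b, h) : ℝ)) + (1 - (w s(c, h) : ℝ)) * (1 - (w s(u, h) : ℝ)) * (1 - (w s(a, h) : ℝ)) * (w s(b, h) : ℝ)) := by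
  rw [real_hubEvent w hcu hca hcb hua hub hab (fun oc ou oa ob => ¬ (ob ∧ (oc ∨ ou ∨ oa))) (fun ω => mem_hSep_b hcu hca hcb hua hub hab)]
  simp only [true_and, false_and, true_or, false_or, or_true, or_false, not_true_eq_false, not_false_eq_true, if_true, if_false]
  ring

/-- `P(hSep{c} ∩ hSep{b}) = n + p`. [this work] -/
theorem real_hSep_cb (hcu : c ≠ u) (hca : c ≠ a) (hcb : c ≠ b) (hua : u ≠ a) (hub : u ≠ b) (hab : a ≠ b) :
    (prodBernoulli w).real (hSep {c} c u a b h ∩ hSep {b} c u a b h) = ((1 - (w s(u, h) : ℝ)) * (1 - (w s(a, h) : ℝ)) * (1 - (w s(b, h) : ℝ)) + (1 - (w s(c, h) : ℝ)) * ((w s(u, h) : ℝ) * (1 - (w s(a, h) : ℝ)) * (1 - (w s(b, h) : ℝ)) + (1 - (w s(u, h) : ℝ)) * (w s(a, h) : ℝ) * (1 - (w s(b, h) : ℝ)) + (1 - (w s(u, h) : ℝ)) * (1 - (w s(a, h) : ℝ)) * (w s(b, h) : ℝ))) + ((1 - (w s(c, h) : ℝ)) * (w s(u, h) : ℝ) *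 (w s(a, h) : ℝ) * (1 - (w s(b, h) : ℝ))) := by
  rw [real_hubEvent w hcu hca hcb hua hub hab (fun oc ou oa ob => ¬ (oc ∧ (ou ∨ oa ∨ ob)) ∧ ¬ (ob ∧ (oc ∨ ou ∨ oa)))
    (fun ω => by rw [mem_inter_iff, mem_hSep_c hcu hca hcb hua hub hab, mem_hSep_b hcu hca hcb hua hub hab])]
  simp only [true_and, false_and, and_true, and_false, true_or, false_or, or_true, or_false, not_true_eq_false, not_false_eq_true,
    if_true, if_false]
  ring

/-- `P(hSep{u,a}) = n + p + d`. [this work] -/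
theorem real_hSep_ua (hcu : c ≠ u) (hca : c ≠ a) (hcb : c ≠ b) (hua : u ≠ a) (hub : u ≠ b) (hab : a ≠ b) :
    (prodBernoulli w).real (hSep {u, a} c u a b h) = ((1 - (w s(u, h) : ℝ)) * (1 - (w s(a, h) : ℝ)) * (1 - (w s(b, h) : ℝ)) + (1 - (w s(c, h) : ℝ)) * ((w s(u, h) : ℝ) * (1 - (w s(a, h) : ℝ)) * (1 - (w s(b, h) : ℝ)) + (1 - (w s(u, h) : ℝ)) * (w s(a, h) : ℝ) * (1 - (w s(b, h) : ℝ)) + (1 - (w s(u, h) : ℝ)) * (1 - (w s(a, h) : ℝ)) * (w s(b, h) : ℝ))) + ((1 - (w s(c, h) : ℝ)) * (w s(u, h) : ℝ) * (w s(a, h) : ℝ) * (1 - (w s(b, h) : ℝ))) + ((w s(c, h) : ℝ) * (1 - (w s(u, h) : ℝ)) * (1 - (w s(a, h) : ℝ)) * (w s(b, h) : ℝ)) := by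
  rw [real_hubEvent w hcu hca hcb hua hub hab (fun oc ou oa ob => ¬ ((ou ∨ oa) ∧ (oc ∨ ob))) (fun ω => mem_hSep_ua hcu hca hcb hua hub hab)]
  simp only [true_and, false_and, and_true, and_false, true_or, false_or, or_true, or_false, not_true_eq_false, not_false_eq_true,
    if_true, if_false]
  ring

/-- `P(hSep{u} ∩ hSep{a}) = n + d`. [this work] -/
theorem real_hSep_u_a (hcu : c ≠ u) (hca : c ≠ a) (hcb : c ≠ b) (hua : u ≠ a) (hub : u ≠ b) (hab : a ≠ b) :
    (prodBernoulli w).real (hSep {u} c u a b h ∩ hSep {a} c u a b h) = ((1 - (w s(u, h) : ℝ)) * (1 - (w s(a, h) : ℝ)) * (1 - (w s(b, h) : ℝ)) + (1 - (w s(c, h) : ℝ)) * ((w s(u, h) : ℝ) * (1 - (w s(a, h) : ℝ)) * (1 - (w s(b, h) : ℝ)) + (1 - (w s(u, h) : ℝ)) * (w s(a, h) : ℝ) * (1 - (w s(b, h) : ℝ)) + (1 - (w s(u, h) : ℝ)) * (1 - (w s(a, h) : ℝ)) * (w s(b, h) : ℝ))) + ((w s(c, h) : ℝ) * (1 - (w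 s(u, h) : ℝ)) * (1 - (w s(a, h) : ℝ)) * (w s(b, h) : ℝ)) := by
  rw [real_hubEvent w hcu hca hcb hua hub hab (fun oc ou oa ob => ¬ (ou ∧ (oc ∨ oa ∨ ob)) ∧ ¬ (oa ∧ (oc ∨ ou ∨ ob)))
    (fun ω => by rw [mem_inter_iff, mem_hSep_u hcu hca hcb hua hub hab, mem_hSep_a hcu hca hcb hua hub hab])]
  simp only [true_and, false_and, and_true, and_false, true_or, false_or, or_true, or_false, not_true_eq_false, not_false_eq_true,
    if_true, if_false]
  ring

/-- `P(hSep{c} ∩ hSep{u} ∩ hSep{a}) = n` (at most one star pair open). [this work] -/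
theorem real_hSep_cua (hcu : c ≠ u) (hca : c ≠ a) (hcb : c ≠ b) (hua : u ≠ a) (hub : u ≠ b) (hab : a ≠ b) :
    (prodBernoulli w).real (hSep {c} c u a b h ∩ hSep {u} c u a b h ∩ hSep {a} c u a b h) = ((1 - (w s(u, h) : ℝ)) * (1 - (w s(a, h) : ℝ)) * (1 - (w s(b, h) : ℝ)) + (1 - (w s(c, h) : ℝ)) * ((w s(u, h) : ℝ) * (1 - (w s(a, h) : ℝ)) * (1 - (w s(b, h) : ℝ)) + (1 - (w s(u, h) : ℝ)) * (w s(a, h) : ℝ) * (1 - (w s(b, h) : ℝ)) + (1 - (w s(u, h) : ℝ)) * (1 - (w s(a, h) : ℝ)) * (w s(b, h) : ℝ))) := by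
  rw [real_hubEvent w hcu hca hcb hua hub hab
    (fun oc ou oa ob => (¬ (oc ∧ (ou ∨ oa ∨ ob)) ∧ ¬ (ou ∧ (oc ∨ oa ∨ ob))) ∧ ¬ (oa ∧ (oc ∨ ou ∨ ob)))
    (fun ω => by rw [mem_inter_iff, mem_inter_iff, mem_hSep_c hcu hca hcb hua hub hab, mem_hSep_u hcu hca hcb hua hub hab, mem_hSep_a hcu hca hcb hua hub hab])]
  simp only [true_and, false_and, and_true, and_false, true_or, false_or, or_true, or_false, not_true_eq_false, not_false_eq_true,
    if_true, if_false]
  ring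

/-- `P(hSep{b} ∩ {¬ (u and a open)}) = n + e` (the prefix pieces of the disjoint-events bound). [this work] -/
theorem real_prefix (hcu : c ≠ u) (hca : c ≠ a) (hcb : c ≠ b) (hua : u ≠ a) (hub : u ≠ b) (hab : a ≠ b) :
    (prodBernoulli w).real (hSep {b} c u a b h ∩ {ω | ¬ (s(u, h) ∈ ω ∧ s(a, h) ∈ ω)}) = ((1 - (w s(u, h) : ℝ)) * (1 - (w s(a, h) : ℝ)) * (1 - (w s(b, h) : ℝ)) + (1 - (w s(c, h) : ℝ)) * ((w s(u, h) : ℝ) * (1 - (w s(a, h) : ℝ)) * (1 - (w s(b, h) : ℝ)) + (1 - (w s(u, h) : ℝ)) * (w s(a, h) : ℝ) * (1 - (w s(b, h) : ℝ)) + (1 - (w s(u, h) : ℝ)) * (1 - (w s(a, h) : ℝ)) * (w s(b, h) : ℝ))) + ((w s(c, h) : ℝ) * (w s(u, h) : ℝ) * (1 - (w s(a, h) : ℝ)) * (1 - (w s(b, h) : ℝ)) + (w s(c, h) : ℝ) * (1 - (w s(u, h) : ℝ)) * (w s(a, h) : ℝ) * (1 - (w s(b, h) : ℝ))) := by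
  rw [real_hubEvent w hcu hca hcb hua hub hab (fun oc ou oa ob => ¬ (ob ∧ (oc ∨ ou ∨ oa)) ∧ ¬ (ou ∧ oa))
    (fun ω => by rw [mem_inter_iff, mem_hSep_b hcu hca hcb hua hub hab, mem_setOf_eq])]
  simp only [true_and, false_and, and_true, and_false, true_or, false_or, or_true, or_false, not_true_eq_false, not_false_eq_true,
    if_true, if_false]
  ring

omit [DecidableEq V] in
/-- `P(u, a open, b closed at the hub) = p + sac` (the creator pieces). [this work] -/
theorem real_creator (hcu : c ≠ u) (hca : c ≠ a) (hcb : c ≠ b) (hua : u ≠ a) (hub : u ≠ b) (hab : a ≠ b) :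
    (prodBernoulli w).real {ω : BondConfig V | s(u, h) ∈ ω ∧ s(a, h) ∈ ω ∧ s(b, h) ∉ ω} = ((1 - (w s(c, h) : ℝ)) * (w s(u, h) : ℝ) * (w s(a, h) : ℝ) * (1 - (w s(b, h) : ℝ))) + ((w s(c, h) : ℝ) * (w s(u, h) : ℝ) * (w s(a, h) : ℝ) * (1 - (w s(b, h) : ℝ))) := by
  rw [real_hubEvent w hcu hca hcb hua hub hab (fun _ ou oa ob => ou ∧ oa ∧ ¬ ob) (fun ω => by rw [mem_setOf_eq])]
  simp only [true_and, false_and, and_true, and_false, not_true_eq_false, not_false_eq_true, if_true, if_false]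
  ring

/-- `P(hSep{c} ∩ hSep{b} ∩ hSep{u}) = n` (at most one star pair open; the `D(0̂)` factor). [this work] -/
theorem real_hSep_cbu (hcu : c ≠ u) (hca : c ≠ a) (hcb : c ≠ b) (hua : u ≠ a) (hub : u ≠ b) (hab : a ≠ b) :
    (prodBernoulli w).real (hSep {c} c u a b h ∩ hSep {b} c u a b h ∩ hSep {u} c u a b h) = ((1 - (w s(u, h) : ℝ)) * (1 - (w s(a, h) : ℝ)) * (1 - (w s(b, h) : ℝ)) + (1 - (w s(c, h) : ℝ)) * ((w s(u, h) : ℝ) * (1 - (w s(a, h) : ℝ)) * (1 - (w s(b, h) : ℝ)) + (1 - (w s(u, h) : ℝ)) * (w s(a, h) : ℝ) * (1 - (w s(b, h) : ℝ)) + (1 - (w s(u, h) : ℝ)) * (1 - (w s(a, h) : ℝ)) * (w s(b, h) : ℝ))) := by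
  rw [real_hubEvent w hcu hca hcb hua hub hab
    (fun oc ou oa ob => (¬ (oc ∧ (ou ∨ oa ∨ ob)) ∧ ¬ (ob ∧ (oc ∨ ou ∨ oa))) ∧ ¬ (ou ∧ (oc ∨ oa ∨ ob)))
    (fun ω => by rw [mem_inter_iff, mem_inter_iff, mem_hSep_c hcu hca hcb hua hub hab, mem_hSep_b hcu hca hcb hua hub hab, mem_hSep_u hcu hca hcb hua hub hab])]
  simp only [true_and, false_and, and_true, and_false, true_or, false_or, or_true, or_false, not_true_eq_false, not_false_eq_true,
    if_true, if_false]
  ring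

end closedforms

end Summit.CriticalPhenomena.PercolationContinuityZ3.Theorems.SuperTerminalQuarticHubProb
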